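import Mathlib.LinearAlgebra.UnitaryGroup
import Literature.Computability.Cryptography.QuantumCircuit
import Literature.Computability.Cryptography.QuantumTuringMachine
import Literature.Computability.Complexity.BoolEncodings
import Literature.Computability.Complexity.TimeBounds
import HarnessLib

/-!
# Nearest-neighbour matchgate circuits are classically simulable (Jozsa–Miyake 2008, Thm. 1)

Topic `Literature/Computability/QuantumComplexity`, model namespace `Matchgate`. Named fact
(D-0014) vendored by a grounder for route `QuantumAdvantage/YangBaxterIslands`: it grounds the
support item `Summit.QuantumAdvantage.QuantumAdvantage.Theses.YangBaxterIslands.YbFreeFermionLine`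
(the free-fermion line `b ∈ ½ℤ` of the homogeneous XXZ brickwork is a nearest-neighbour circuit of
ONE allowable matchgate `G(e^{-ibπ}𝟙, e^{ibπ}R_x(4aπ))`, `R_x(4aπ) = [[cos 2aπ, -i sin 2aπ],
[-i sin 2aπ, cos 2aπ]]`, run on a computational-basis input, wire `0`
measured), and is the simulation theorem behind the "matchgate island" quoted by routes
`SpinorFlattening` / `FermionicMagic` and by `Literature.Barriers.QuantumAdvantage.LatticeRigidity`.

* `Matchgate.gateGAB A B` — the two-qubit gate `G(A,B)` of Jozsa–Miyake eq. (1): `A` acts on the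
  even-parity subspace `span{|00⟩, |11⟩}` (basis in this order), `B` on the odd-parity subspace
  `span{|01⟩, |10⟩}` (basis in this order); rows index the OUTPUT basis state (tree convention of
  `Cryptography.placeGate`, `U x y = ⟨x|U|y⟩`).
* `Matchgate.IsMatchgate U` — `U = G(A,B)` for some unitary `A, B` with `det A = det B` (an
  "allowable" `G(A,B)`; JM08 write `G̃(A,B)` when the determinants differ — those are NOT covered,
  indeed `G(A,B)` plus SWAP `= G̃(𝟙, X)` is universal, JM08 §5).
* `Matchgate.gateSet Op M` — a gate set all of whose symbols are two-qubit gates `M g`;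
  `Matchgate.IsNearestNeighbour` — a placed gate sits on two ADJACENT wires `(j, j+1)` (either
  orientation; oracle gates are excluded); `Matchgate.Instance` — a circuit over such a gate set on
  `n + m` wires, a basis input `x ∈ {0,1}^n` (ancillas `|0^m⟩`), and a precision `k` (unary), with
  its Boolean code `Instance.encode` (the tree's `QCircuit.sigmaEncode` + `boolPair`, as in
  `StabilizerSimulation.CliffordTInstance.encode`).
* `JozsaMiyake2008_thm1` — THE FACT: for a finite alphabet of allowable matchgates with
  polynomial-time computable entries, the wire-`0` acceptance probability of any nearest-neighbour
  circuit on any basis input is computable to `k` bits in time polynomial in the size of the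
  circuit description and `k` (strong simulation of a single output line).

## Source, as printed

R. Jozsa, A. Miyake, *Matchgates and classical simulation of quantum circuits*, Proc. R. Soc. A
464 (2008) 3089–3106 = arXiv:0804.4050, **Theorem 1** (p. 3 of the arXiv text): "Consider any
uniform (hence poly-sized) quantum circuit family comprising only `G(A,B)` gates such that: (i) the
`G(A,B)` gates act on nearest neighbour (n.n.) lines only; (ii) the input state is any product
state; (iii) the output is a final measurement in the computational basis on any single line. Then
the output may be classically efficiently simulated. More precisely for any `k` we can classically
efficiently compute the expectation value `⟨Z_k⟩_out = p₀ − p₁`", where (ibid., the paragraph after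
the theorem) "classically efficiently simulatable" means "the probabilities of measurement outcomes
can be computed by classical means to `m` digits of accuracy in poly`(n, m)` time". Earlier forms:
Valiant 2002 (SIAM J. Comput. 31, Thm. 1–2: matchgate circuits on basis inputs), Terhal–DiVincenzo
2002 (Phys. Rev. A 65, 032325, §3–4: noninteracting-fermion circuits, many-line outputs, adaptive).

## Faithfulness notes (what is weaker than print, what is made explicit)

* SPECIALISED (weaker than print): computational-basis inputs `|x⟩|0^m⟩` only (JM08 allow any
  product state); the measured line is wire `0` (JM08: any single line `k` — relabel); the gate
  alphabet is FINITE and FIXED (`[Fintype Op]`), the circuit being an explicit input.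
* MADE EXPLICIT (implicit in print): the gate entries are polynomial-time computable complex
  numbers (`Cryptography.IsPolyTimeComputableComplex`, Ko 1991 / Bernstein–Vazirani 1997 §6) — the
  printed proof multiplies the `SO(2n)` images of the gates and evaluates a quadratic form, i.e. it
  does arithmetic on the entries; with non-computable entries no classical simulation statement can
  hold (Adleman–DeMarrais–Huang 1997). "Uniform (hence poly-sized) family" becomes: the circuit
  description is part of the input and the running time is polynomial in its length (`sigmaEncode`
  has length ≥ number of gates and ≥ number of ancillas), with the precision `k` in unary — the
  standard reading of "poly`(n, m)` time".
* Output convention: an integer `a` with `|a / 2^k − p| ≤ 2^{-k}` (dyadic `k`-bit approximation of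
  the acceptance probability `p`; "m digits" ↔ `k = ⌈m log₂ 10⌉` bits).

## Mathlib / tree

Mathlib has no quantum circuits. Tree: `QReg`, `QGateSet`, `placeGate` (Q1), `QGate`, `QCircuit`,
`QCircuit.acceptProb`, `QCircuit.sigmaEncode` (Q2), `PolyTimeComputable`, `boolPair`,
`encodingIntBool` (G01), `IsPolyTimeComputableComplex` (QuantumTuringMachine.lean). Related but
different: `GaussianRank.majorana` / `SlaterState*.lean` (the Jordan–Wigner machinery a discharge
would use; `SlaterStateMatchgate.lean` treats the number-preserving n.n. matchgates `Γ(V)`),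
`Literature.Barriers.QuantumAdvantage.LatticeRigidity` (cites JozsaEtAl2009 for the `SO(2n)`
compression). Searched `lean search --decl 'JozsaMiyake|TerhalDivincenzo|Valiant2002|matchgate'`:
no prior statement of this theorem in the tree.

## Not here

The `SO(2n)` (Clifford-algebra) representation `U† c_μ U = Σ_ν R_{μν} c_ν` (JM08 Thm. 3), product
input states (JM08 Thm. 4), many-line / adaptive outputs (Terhal–DiVincenzo 2002), the converse
universality results (JM08 §5), and any discharge.
-/

open Matrix Computability Literature.Computability.Complexity Literature.Computability.Cryptography

namespace Literature.Computability.QuantumComplexity.Matchgate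

/-! ### Matchgates -/

/-- The two-qubit gate `G(A,B)` of Jozsa–Miyake (eq. (1)): in the computational basis
`|00⟩, |01⟩, |10⟩, |11⟩` it is `[[p,0,0,q],[0,w,x,0],[0,y,z,0],[r,0,0,s]]` with `A = [[p,q],[r,s]]`
acting on the even-parity subspace (basis `|00⟩ ↦ 0`, `|11⟩ ↦ 1`) and `B = [[w,x],[y,z]]` on the
odd-parity subspace (basis `|01⟩ ↦ 0`, `|10⟩ ↦ 1`); all even/odd cross entries vanish. Rows index
the output basis state (`x`), columns the input (`y`), as for `Cryptography.placeGate`; a basis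
label `x : QReg 2 = Fin 2 → Bool` is `|x 0, x 1⟩`, so within each parity block the index is the
first bit `x 0`. [cite: JozsaMiyake2008, §1 eq. (1)] -/
def gateGAB (A B : Matrix (Fin 2) (Fin 2) ℂ) : Matrix (QReg 2) (QReg 2) ℂ :=
  Matrix.of fun x y =>
    if x 0 = x 1 then
      (if y 0 = y 1 then A (if x 0 then 1 else 0) (if y 0 then 1 else 0) else 0)
    else
      (if y 0 = y 1 then 0 else B (if x 0 then 1 else 0) (if y 0 then 1 else 0))

/-- An (allowable) **matchgate**: `U = G(A,B)` with `A, B ∈ U(2)` and `det A = det B` ("`A` and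
`B` are both in `SU(2)` or both in `U(2)` with the same determinant"). Gates `G̃(A,B)` with
`det A ≠ det B` are deliberately excluded. [cite: JozsaMiyake2008, §1 (allowable G(A,B) gates)] -/
def IsMatchgate (U : Matrix (QReg 2) (QReg 2) ℂ) : Prop :=
  ∃ A B : Matrix (Fin 2) (Fin 2) ℂ, A ∈ Matrix.unitaryGroup (Fin 2) ℂ ∧
    B ∈ Matrix.unitaryGroup (Fin 2) ℂ ∧ A.det = B.det ∧ U = gateGAB A B

/-- A gate set all of whose symbols `g : Op` are two-qubit gates `M g` (a "circuit comprising only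
`G(A,B)` gates" is a circuit over `gateSet Op M` with every `M g` a matchgate). [cite: JozsaMiyake2008, Thm 1] -/
def gateSet (Op : Type) (M : Op → Matrix (QReg 2) (QReg 2) ℂ) : QGateSet :=
  ⟨Op, fun _ => 2, M⟩

/-- The gate alphabet of `gateSet Op M` is `Op`; transport its `Encodable` structure (instance
search does not unfold the definition `gateSet`; needed for `QCircuit.sigmaEncode`). [folklore] -/
instance instEncodableOp (Op : Type) [Encodable Op] (M : Op → Matrix (QReg 2) (QReg 2) ℂ) :
    Encodable (gateSet Op M).Op :=
  inferInstanceAs (Encodable Op)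

/-- A placed gate of a matchgate circuit acts on **nearest-neighbour lines**: its two wires are
`(j, j+1)` for some `j`, in either orientation (`SWAP∘G(A,B)∘SWAP = G(A, XBX)` is again allowable,
so the orientation is immaterial). Oracle gates are not matchgates: excluded. Hypothesis (i) of
Jozsa–Miyake's Theorem 1; without it (`G(A,B)` on next-nearest-neighbour lines, or with SWAP) the
gates are universal (JM08 §5). [cite: JozsaMiyake2008, Thm 1 (i)] -/
def IsNearestNeighbour {Op : Type} {M : Op → Matrix (QReg 2) (QReg 2) ℂ} {N : ℕ} :
    QGate (gateSet Op M) N → Prop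
  | .gate _ e =>
      ((e ⟨0, by exact Nat.two_pos⟩ : Fin N) : ℕ) + 1 = e ⟨1, by exact Nat.one_lt_two⟩ ∨
        ((e ⟨1, by exact Nat.one_lt_two⟩ : Fin N) : ℕ) + 1 = e ⟨0, by exact Nat.two_pos⟩
  | .oracle _ _ => False

/-! ### Simulation instances -/

/-- An instance of the single-line strong-simulation problem for matchgate circuits: a circuit over
`gateSet Op M` on `n + m` wires, the classical input `x ∈ {0,1}^n` for the first `n` wires (the `m`
ancillas start in `|0⟩`; together a computational-basis product state, hypothesis (ii) of JM08
Thm. 1 specialised), and the precision parameter `k` (target additive error `2^{-k}` for the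
wire-`0` outcome probability, hypothesis (iii): a single line measured).
[cite: JozsaMiyake2008, Thm 1 (ii)–(iii)] -/
structure Instance (Op : Type) (M : Op → Matrix (QReg 2) (QReg 2) ℂ) where
  /-- Number of input wires. -/
  n : ℕ
  /-- Number of ancilla wires (initialised to `|0⟩`). -/
  m : ℕ
  /-- The circuit on `n + m` wires. -/
  circ : QCircuit (gateSet Op M) (n + m)
  /-- The classical input on the first `n` wires. -/
  x : QReg n
  /-- Precision: additive error `2^{-k}`. -/
  k : ℕ

namespace Instance

variable {Op : Type} {M : Op → Matrix (QReg 2) (QReg 2) ℂ}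

/-- Boolean code of an instance: `boolPair` of the tree's circuit description
`QCircuit.sigmaEncode ⟨n, m, circ⟩` (ancilla count in unary, so the code is at least as long as the
number of gates and of wires used), the input bits, and `k` in **unary** (so that "poly`(n, m)`
time" for `m` digits is time polynomial in the code length). Same layout as
`StabilizerSimulation.CliffordTInstance.encode`. [cite: AroraBarak2009, §0.1 and §6.1 (descriptions of circuits)] -/
def encode [Encodable Op] (i : Instance Op M) : List Bool :=
  boolPair (QCircuit.sigmaEncode ⟨i.n, i.m, i.circ⟩) (boolPair (List.ofFn i.x) (unaryEncodeNat i.k))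

/-- The instance's circuit uses nearest-neighbour placed gates only (and no oracle gates).
[cite: JozsaMiyake2008, Thm 1 (i)] -/
def IsNearestNeighbour (i : Instance Op M) : Prop :=
  ∀ g ∈ i.circ.gates, Matchgate.IsNearestNeighbour g

/-- The quantity to be computed: the probability `p₁` that wire `0` of `U_circ |x⟩|0^m⟩` reads `1`
(`QCircuit.acceptProb`, oracle `0`; JM08's `p₁ = (1 − ⟨Z₀⟩_out)/2`). [cite: JozsaMiyake2008, Thm 1] -/
noncomputable def acceptProb (i : Instance Op M) : ℝ :=
  i.circ.acceptProb 0 i.x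

end Instance

/-! ### The theorem -/

/-- **Jozsa–Miyake 2008, Theorem 1 (nearest-neighbour matchgate circuits on product inputs with a
single-line measurement are classically efficiently simulable)**, in the tree's terms and with the
implicit effectiveness hypothesis made explicit: for every FINITE alphabet `Op` of two-qubit gates
`M g` that are allowable matchgates (`IsMatchgate`: `G(A,B)`, `A, B` unitary, `det A = det B`) with
polynomial-time computable entries, there is an integer-valued function `est`, computable in time
polynomial in the length of the instance code (circuit description, input bits, precision `k` in
unary), such that for every instance whose gates all sit on nearest-neighbour lines,
`|est i / 2^k − p₁(i)| ≤ 2^{-k}`, where `p₁(i)` is the probability that wire `0` reads `1` after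
running the circuit on `|x⟩|0^m⟩`. As printed: "for any `k` we can classically efficiently compute
`⟨Z_k⟩_out = p₀ − p₁`" … "to `m` digits of accuracy in poly`(n,m)` time". Weaker than print in:
basis (not arbitrary product) inputs, wire `0` (not any line), finite fixed alphabet; cf. Valiant
2002 Thm. 1–2 and Terhal–DiVincenzo 2002 §3–4 for the basis-input case with many-line outputs.
Grounds `Summit.QuantumAdvantage.QuantumAdvantage.Theses.YangBaxterIslands.YbFreeFermionLine`
(item = this fact ∘ [the XXZ gate at `b ∈ ½ℤ` is `G(e^{-ibπ}𝟙, e^{ibπ}R_x(4aπ))`, allowable iff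
`e^{4ibπ} = 1`; brickwork bonds are `(j, j+1)`; entries `cos 2aπ, sin 2aπ, e^{±ibπ}` are
polynomial-time computable] ∘ [`k = 2`, compare with `1/2`, precompose the `FP` encoder `f`,
`preimage_mem_P`]). [cite: JozsaMiyake2008, Thm 1] -/
def JozsaMiyake2008_thm1 : Prop :=
  ∀ (Op : Type) [Fintype Op] [Encodable Op] (M : Op → Matrix (QReg 2) (QReg 2) ℂ),
    (∀ g, IsMatchgate (M g)) →
    (∀ g u v, IsPolyTimeComputableComplex (M g u v)) →
    ∃ est : Instance Op M → ℤ,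
      PolyTimeComputable Instance.encode encodingIntBool.encode est ∧
      ∀ i : Instance Op M, i.IsNearestNeighbour →
        |(est i : ℝ) / 2 ^ i.k - i.acceptProb| ≤ (1 / 2 : ℝ) ^ i.k

end Literature.Computability.QuantumComplexity.Matchgate
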